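import Summits.CriticalPhenomena.PercolationContinuityZ3.Theorems.PercNearOneGluingAdditiveGluingFingerML3Reductions
import HarnessLib

/-! # Crux `PercNearOneGluing.AdditiveGluing` (stmt-CriticalPhenomena-4576) — `AdditiveGluing` for the FINGER class modulo glue-drift
# (seat (b) V⁺-form, depth prover `png-dp-vplus`)

Support file (`--supports stmt-CriticalPhenomena-4576`); no definitions, no named facts.  Companion of `…AdditiveGluingTFingers.lean`
(`additiveGluing_fingers_of_FML3`: the finger class from the UNIVERSAL finger multi-edge Lemma 3, registered open stub `stub_fingerML3_vp`) and
`…AdditiveGluingFingerML3Reductions.lean` (FML3 in the cases the landed tools settle).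

`additiveGluing_fingers_of_noGlueDrift`: let `o ∉ A ∋ b` be an observer whose non-relay neighbours are FINGERS (adjacent only to `o` and to relays),
`K = q_∅` the weighting with the star of `o` killed, and for a finger layer `N` let `q_∅ ⊖ N` kill the pairs at `N` as well and `q_N = K/N` glue `N`.
Suppose that for every Question-9 designation `e` of `o` (a minimiser of `μ_K(· ↔ b)` over `A`) and every non-empty block `N` of fingers of `o`
(`Disjoint N A`) ONE of the following holds:
 (i) `μ_K(e ↔ b) ≤ μ_K(v ↔ b)` for some `v ∈ N` (the designation is below a finger of the layer, unglued), or
 (ii) there is `c ∉ N`, `(q_∅ ⊖ N)`-minimal over `A` (e.g. the layer's own Question-9 designation), with `μ_{q_N}(e ↔ b) ≤ μ_{q_N}(c ↔ b)`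
      ("no glue-drift": gluing the layer does not lift `e` above the layer's Question-9 designation).
Then the `AdditiveGluing` inequality holds at `o`: `μ_w(o ↔ A) − t ≤ μ_w(o ↔ b)` for all `t ≥ 0` with `μ_w(a ↔ b) ≥ 1 − t` on `A`.
Proof = `additiveGluing_fingers_of_FML3` with the universal FML3 replaced, layer by layer, by `fingerML3_of_le_blockVertex` /
`fingerML3_of_gluedWitness`.  The universal statement (every finger observer) is `stub_fingerML3_vp`; the depth-prover numerics find no finger
layer violating (i) ∨ (ii) (exact enumeration, n ≤ 8), so this theorem settles every finger instance examined, and isolates the residual of the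
finger class as GLUE-DRIFT: a Question-9 designation of `o` that, after gluing a finger layer, overtakes that layer's own Question-9 designation
while staying above every finger of the layer in `K`.
[cite: KozmaNitzan2024, Thm 5 (pp. 13–14), Lemma 3(i) (pp. 6–7), Lemma 5 (p. 13), Question 9 (p. 36)]
-/

namespace Summit.CriticalPhenomena.PercolationContinuityZ3.Theorems

open MeasureTheory Set
open Literature.Probability.LatticeModels (prodBernoulli)
open Literature.Probability.Percolation (BondConfig openConn openGraph)
open scoped BigOperators Classical

noncomputable section

section FingersNoGlueDrift

open Literature.Probability.LatticeModels Literature.Probability.Percolation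

variable {n : ℕ}

/-- **`AdditiveGluing` for finger observers without glue-drift.**  See the module docstring: for every Question-9 designation `e` of `o` and
every finger layer `N`, either `e` is `K`-below a finger of `N`, or `e` is `K/N`-below some `(K ⊖ N)`-minimal vertex `c ∉ N`; then
`μ_w(o ↔ A) − t ≤ μ_w(o ↔ b)` whenever `t ≥ 0` and `μ_w(a ↔ b) ≥ 1 − t` on `A`.
[cite: KozmaNitzan2024, Thm 5 (pp. 13–14), Lemma 3(i) (pp. 6–7), Lemma 5 (p. 13), Question 9 (p. 36)] -/
theorem additiveGluing_fingers_of_noGlueDrift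
    (w : Sym2 (Fin n) → unitInterval) (A : Finset (Fin n)) (o b : Fin n) (hb : b ∈ A) (ho : o ∉ A)
    (hfing : ∀ x : Fin n, x ∉ A → x ≠ o → (w s(o, x) : ℝ) ≠ 0 →
      ∀ y : Fin n, y ∉ A → y ≠ o → y ≠ x → (w s(x, y) : ℝ) = 0)
    (hlayers : ∀ e ∈ A,
      (∀ a ∈ A,
        (prodBernoulli (fun e' : Sym2 (Fin n) =>
            if (∃ y ∈ e', y ∈ ({o} : Finset (Fin n))) then (0 : unitInterval) else w e')).real (openConn e b) ≤
          (prodBernoulli (fun e' : Sym2 (Fin n) =>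
            if (∃ y ∈ e', y ∈ ({o} : Finset (Fin n))) then (0 : unitInterval) else w e')).real (openConn a b)) →
      ∀ N : Finset (Fin n), N.Nonempty → Disjoint N A → (∀ v ∈ N, v ≠ o ∧ (w s(o, v) : ℝ) ≠ 0) →
        (∃ v ∈ N,
          (prodBernoulli (fun e' : Sym2 (Fin n) =>
              if (∃ y ∈ e', y ∈ ({o} : Finset (Fin n))) then (0 : unitInterval) else w e')).real (openConn e b) ≤
            (prodBernoulli (fun e' : Sym2 (Fin n) =>
              if (∃ y ∈ e', y ∈ ({o} : Finset (Fin n))) then (0 : unitInterval) else w e')).real (openConn v b)) ∨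
        (∃ c : Fin n, c ∉ N ∧
          (∀ a ∈ A,
            (prodBernoulli (fun e' : Sym2 (Fin n) => if (∃ y ∈ e', y ∈ N) then (0 : unitInterval) else
                if (∃ y ∈ e', y ∈ ({o} : Finset (Fin n))) then (0 : unitInterval) else w e')).real (openConn c b) ≤
              (prodBernoulli (fun e' : Sym2 (Fin n) => if (∃ y ∈ e', y ∈ N) then (0 : unitInterval) else
                if (∃ y ∈ e', y ∈ ({o} : Finset (Fin n))) then (0 : unitInterval) else w e')).real (openConn a b)) ∧
          (prodBernoulli (fun e' : Sym2 (Fin n) => if (∀ y ∈ e', y ∈ N) ∧ ¬ e'.IsDiag then 1 else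
              if (∃ y ∈ e', y ∈ ({o} : Finset (Fin n))) then (0 : unitInterval) else w e')).real (openConn e b) ≤
            (prodBernoulli (fun e' : Sym2 (Fin n) => if (∀ y ∈ e', y ∈ N) ∧ ¬ e'.IsDiag then 1 else
              if (∃ y ∈ e', y ∈ ({o} : Finset (Fin n))) then (0 : unitInterval) else w e')).real (openConn c b))) :
    ∀ t : ℝ, 0 ≤ t →
      (∀ a ∈ A, 1 - t ≤ (prodBernoulli w).real (openConn a b)) →
      (prodBernoulli w).real (⋃ a ∈ A, openConn o a) - t ≤ (prodBernoulli w).real (openConn o b) := by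
  intro t _ hA
  have hSA : Disjoint ({o} : Finset (Fin n)) A := Finset.disjoint_singleton_left.2 ho
  -- Question-9 designation of `o`: a minimiser of the star-killed two-point function
  obtain ⟨e, he, hmin⟩ := Finset.exists_min_image A
    (fun a => (prodBernoulli (fun e' : Sym2 (Fin n) =>
      if (∃ y ∈ e', y ∈ ({o} : Finset (Fin n))) then (0 : unitInterval) else w e')).real (openConn a b)) ⟨b, hb⟩
  have hcert := T_block_certificate w A {o} e b hb hSA he hmin
  -- the free layers of positive mass are finger blocks, on which FML3 gives a non-negative bracket
  have hsum : 0 ≤ ∑ N ∈ (Finset.univ : Finset (Finset (Fin n))).filter (fun N => N.Nonempty ∧ Disjoint N A),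
      (prodBernoulli (fun e' : Sym2 (Fin n) =>
          if (∀ y ∈ e', y ∈ ({o} : Finset (Fin n))) ∧ ¬ e'.IsDiag then 1 else w e')).real
          {ω : BondConfig (Fin n) | ∀ y : Fin n, y ∈ N ↔ (y ∉ ({o} : Finset (Fin n)) ∧
            ∃ o' ∈ ({o} : Finset (Fin n)), s(o', y) ∈ ω)} *
        ((prodBernoulli (fun e' : Sym2 (Fin n) =>
            if (∀ y ∈ e', y ∈ N) ∧ ¬ e'.IsDiag then 1 else
              if (∃ y ∈ e', y ∈ ({o} : Finset (Fin n))) then 0 else w e')).real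
            (⋃ v ∈ N, ⋃ a ∈ A, openConn v a)ᶜ +
          (prodBernoulli (fun e' : Sym2 (Fin n) =>
            if (∀ y ∈ e', y ∈ N) ∧ ¬ e'.IsDiag then 1 else
              if (∃ y ∈ e', y ∈ ({o} : Finset (Fin n))) then 0 else w e')).real
            (⋃ v ∈ N, openConn v b) -
          (prodBernoulli (fun e' : Sym2 (Fin n) =>
            if (∀ y ∈ e', y ∈ N) ∧ ¬ e'.IsDiag then 1 else
              if (∃ y ∈ e', y ∈ ({o} : Finset (Fin n))) then 0 else w e')).real
            (openConn e b)) := by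
    refine Finset.sum_nonneg fun N hN => ?_
    obtain ⟨hNne, hNA⟩ := (Finset.mem_filter.1 hN).2
    by_cases hbad : ∃ y ∈ N, y = o ∨ (w s(o, y) : ℝ) = 0
    · -- a layer containing `o` itself or a non-neighbour of `o` has mass `0`
      obtain ⟨y, hyN, hy⟩ := hbad
      have hw0 : (prodBernoulli (fun e' : Sym2 (Fin n) =>
          if (∀ y ∈ e', y ∈ ({o} : Finset (Fin n))) ∧ ¬ e'.IsDiag then 1 else w e')).real
          {ω : BondConfig (Fin n) | ∀ y : Fin n, y ∈ N ↔ (y ∉ ({o} : Finset (Fin n)) ∧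
            ∃ o' ∈ ({o} : Finset (Fin n)), s(o', y) ∈ ω)} = 0 := by
        rcases hy with rfl | hy0
        · exact (T_layer_empty_of_mem {y} N y hyN (Finset.mem_singleton_self y)).symm ▸ measureReal_empty
        · by_cases hyo : y = o
          · subst hyo
            exact (T_layer_empty_of_mem {y} N y hyN (Finset.mem_singleton_self y)).symm ▸ measureReal_empty
          · refine T_layer_null w {o} N y hyN (by simpa using hyo) fun v hv => ?_
            rw [Finset.mem_singleton.1 hv]
            exact hy0
      rw [hw0, zero_mul]
    · -- all of `N` are fingers: apply FML3 in the star-killed weighting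
      push Not at hbad
      refine mul_nonneg measureReal_nonneg ?_
      set K : Sym2 (Fin n) → unitInterval :=
        fun e' => if (∃ y ∈ e', y ∈ ({o} : Finset (Fin n))) then (0 : unitInterval) else w e' with hK
      have hfreeK : ∀ v ∈ N, ∀ y : Fin n, y ∉ A → y ∉ N → (K s(v, y) : ℝ) = 0 := by
        intro v hv y hyA hyN
        by_cases hoy : ∃ z ∈ s(v, y), z ∈ ({o} : Finset (Fin n))
        · simp only [hK, hoy, if_true]
          rfl
        · simp only [hK, hoy, if_false]
          have hvo : v ≠ o := (hbad v hv).1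
          have hyo : y ≠ o := fun h => hoy ⟨y, Sym2.mem_mk_right v y, Finset.mem_singleton.2 h⟩
          have hvA : v ∉ A := Finset.disjoint_left.1 hNA hv
          have hyv : y ≠ v := fun h => hyN (h ▸ hv)
          exact hfing v hvA hvo (hbad v hv).2 y hyA hyo hyv
      have hX1 : (prodBernoulli (fun e' : Sym2 (Fin n) => if (∀ y ∈ e', y ∈ N) ∧ ¬ e'.IsDiag then 1 else K e')).real
            ({ω : Set (Sym2 (Fin n)) | ∃ v ∈ N, ∃ a ∈ A, s(v, a) ∈ ω} ∩ openConn e b) ≤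
          (prodBernoulli (fun e' : Sym2 (Fin n) => if (∀ y ∈ e', y ∈ N) ∧ ¬ e'.IsDiag then 1 else K e')).real
            ({ω : Set (Sym2 (Fin n)) | ∃ v ∈ N, ∃ a ∈ A, s(v, a) ∈ ω} ∩ ⋃ v ∈ N, openConn v b) := by
        rcases hlayers e he hmin N hNne hNA hbad with ⟨v, hv, hle⟩ | ⟨c, hcN, hcA, hle⟩
        · exact fingerML3_of_le_blockVertex K A N e b v hb hNA hv hfreeK hle
        · exact fingerML3_of_gluedWitness K A N e c b hNA hcN hfreeK hcA hle
      exact T_finger_nonneg_of_X1 K A N e b hNA hfreeK hX1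
  -- assemble: `T_e^{w}(o) ≥ 0`, then the additive inequality at level `t`
  have h1 : (prodBernoulli (fun e' : Sym2 (Fin n) =>
      if (∃ y ∈ e', y ∈ ({o} : Finset (Fin n))) then (0 : unitInterval) else w e')).real (openConn e b) ≤ 1 :=
    measureReal_le_one
  have h2 : 0 ≤ (prodBernoulli (fun e' : Sym2 (Fin n) =>
          if (∀ y ∈ e', y ∈ ({o} : Finset (Fin n))) ∧ ¬ e'.IsDiag then 1 else w e')).real
          {ω : BondConfig (Fin n) | ∀ y : Fin n, y ∈ (∅ : Finset (Fin n)) ↔ (y ∉ ({o} : Finset (Fin n)) ∧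
            ∃ o' ∈ ({o} : Finset (Fin n)), s(o', y) ∈ ω)} := measureReal_nonneg
  have hT : 0 ≤ (prodBernoulli (fun e' : Sym2 (Fin n) =>
          if (∀ y ∈ e', y ∈ ({o} : Finset (Fin n))) ∧ ¬ e'.IsDiag then 1 else w e')).real
          (⋃ v ∈ ({o} : Finset (Fin n)), ⋃ a ∈ A, openConn v a)ᶜ +
        (prodBernoulli (fun e' : Sym2 (Fin n) =>
          if (∀ y ∈ e', y ∈ ({o} : Finset (Fin n))) ∧ ¬ e'.IsDiag then 1 else w e')).real
          (⋃ v ∈ ({o} : Finset (Fin n)), openConn v b) -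
        (prodBernoulli (fun e' : Sym2 (Fin n) =>
          if (∀ y ∈ e', y ∈ ({o} : Finset (Fin n))) ∧ ¬ e'.IsDiag then 1 else w e')).real
          (openConn e b) := by
    nlinarith
  rw [goodStep24_glue_singleton w o] at hT
  simp only [Finset.mem_singleton, Set.iUnion_iUnion_eq_left] at hT
  have hc : (prodBernoulli w).real (⋃ a ∈ A, openConn o a)ᶜ = 1 - (prodBernoulli w).real (⋃ a ∈ A, openConn o a) := by
    rw [measureReal_compl (MeasurableSet.of_discrete), probReal_univ]
  rw [hc] at hT
  -- `1 - t ≤ μ_w(e ↔ b)`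
  have hAe := hA e he
  linarith


/-- Registered rung `stub_additiveGluingFingersNoGlueDrift_vp` of crux stmt-CriticalPhenomena-4576 (depth prover png-dp-vplus, seat (b) V⁺-form):
`AdditiveGluing` for finger observers without glue-drift — `additiveGluing_fingers_of_noGlueDrift`, closed statement.
[cite: KozmaNitzan2024, Thm 5 (pp. 13–14), Lemma 3(i) (pp. 6–7), Question 9 (p. 36)] -/
theorem stub_additiveGluingFingersNoGlueDrift_vp : ∀ (n : ℕ) (w : Sym2 (Fin n) → unitInterval) (A : Finset (Fin n)) (o b : Fin n), b ∈ A → o ∉ A → (∀ x : Fin n, x ∉ A → x ≠ o → (w s(o, x) : ℝ) ≠ 0 → ∀ y : Fin n, y ∉ A → y ≠ o → y ≠ x → (w s(x, y) : ℝ) = 0) → (∀ e ∈ A, (∀ a ∈ A, (Literature.Probability.LatticeModels.prodBernoulli (fun e' : Sym2 (Fin n) => if (∃ y ∈ e', y ∈ ({o} : Finset (Fin n))) then (0 : unitInterval) else w e')).real (Literature.Probability.Percolation.openConn e b) ≤ (Literature.Probability.LatticeModels.prodBernoulli (fun e' : Sym2 (Fin n) => if (∃ y ∈ e', y ∈ ({o}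 : Finset (Fin n))) then (0 : unitInterval) else w e')).real (Literature.Probability.Percolation.openConn a b)) → ∀ N : Finset (Fin n), N.Nonempty → Disjoint N A → (∀ v ∈ N, v ≠ o ∧ (w s(o, v) : ℝ) ≠ 0) → (∃ v ∈ N, (Literature.Probability.LatticeModels.prodBernoulli (fun e' : Sym2 (Fin n) => if (∃ y ∈ e', y ∈ ({o} : Finset (Fin n))) then (0 : unitInterval) else w e')).real (Literature.Probability.Percolation.openConn e b) ≤ (Literature.Probability.LatticeModels.prodBernoulli (fun e' : Sym2 (Fin n) => if (∃ y ∈ e', y ∈ ({o} : Finset (Fin n))) then (0 : unitInterval) else w e')).real (Literature.Probability.Percolation.openConn v b)) ∨ (∃ c : Fin n, c ∉ N ∧ (∀ a ∈ A, (Literature.Probability.LatticeModels.prodBernoulli (fun e' : Sym2 (Fin n) => if (∃ y ∈ e', y ∈ N) then (0 : unitInterval) else if (∃ y ∈ e', y ∈ ({o} : Finset (Fin n))) then (0 : unitInterval) else w e')).real (Literature.Probability.Percolation.openConn c b) ≤ (Literature.Probability.LatticeModels.prodBernoulli (fun e' : Sym2 (Fin n) => if (∃ y ∈ e', y ∈ N)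 then (0 : unitInterval) else if (∃ y ∈ e', y ∈ ({o} : Finset (Fin n))) then (0 : unitInterval) else w e')).real (Literature.Probability.Percolation.openConn a b)) ∧ (Literature.Probability.LatticeModels.prodBernoulli (fun e' : Sym2 (Fin n) => if (∀ y ∈ e', y ∈ N) ∧ ¬ e'.IsDiag then 1 else if (∃ y ∈ e', y ∈ ({o} : Finset (Fin n))) then (0 : unitInterval) else w e')).real (Literature.Probability.Percolation.openConn e b) ≤ (Literature.Probability.LatticeModels.prodBernoulli (fun e' : Sym2 (Fin n) => if (∀ y ∈ e', y ∈ N) ∧ ¬ e'.IsDiag then 1 else if (∃ y ∈ e', y ∈ ({o} : Finset (Fin n))) then (0 : unitInterval) else w e')).real (Literature.Probability.Percolation.openConn c b))) → ∀ t : ℝ, 0 ≤ t → (∀ a ∈ A, 1 - t ≤ (Literature.Probability.LatticeModels.prodBernoulli w).real (Literature.Probability.Percolation.openConn a b)) → (Literature.Probability.LatticeModels.prodBernoulli w).real (⋃ a ∈ A, Literature.Probability.Percolation.openConn o a) - t ≤ (Literature.Probability.LatticeModels.prodBernoulli w).real (Literature.Probability.Percolation.openConn o b) :=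
  fun _ w A o b hb ho hfing hlayers => additiveGluing_fingers_of_noGlueDrift w A o b hb ho hfing hlayers

end FingersNoGlueDrift

end

end Summit.CriticalPhenomena.PercolationContinuityZ3.Theorems
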